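import Literature.MathematicalPhysics.QuantumFieldTheory.Balaban1983to89.T3LogComparisonSocket

/-!
# Route `UnitScaleTilt` — crux K1bR-pr `FluctuationComparisonRegPr` (stmt-QuantumFields-19201), stub `stub_logComparisonRegPr`:
# RIGIDITY OVER THE SOCKET — two admissible two-sided representations of the same run differ by their constants up to the sum of their
# remainders; hence the cut-off-Cauchy property is INVARIANT under the change of admissible data
# (support file `--supports stmt-QuantumFields-19201`; the stub stays open)

Fleet lead `ym-ust-19201-p1` (gen 1); route owner ruling g15-№1 (5) (2026-08-26T14:06:05Z): «ADD one S-sized hypothesis-free file: RIGIDITY over the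
socket».  WHAT THIS IS: pure bookkeeping over ★ym-ust-19201-p2's schemas `T3LogComparisonSocket.TwoSidedRepAt` / `PintCauchyAt` (p448460) — the
formal witness of the owner's point (2) that an UNSTRUCTURED representation is rigid only up to `± Rm`: if `(Pint, E, Rm)` and `(Pint′, E′, Rm′)` both
represent run `K` at height `n` ((41)↾trivial history ∧ (47)), then a.e. on the small data where the restricted height density is positive
`|Pint K n V − Pint′ K n V − (E K n − E′ K n)| ≤ Rm K n + Rm′ K n` (`abs_pint_sub_pint_le`), and consequently `PintCauchyAt m Pint → PintCauchyAt m Pint′`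
for every `m ≥ 1` with radii `r′_K + (Rm + Rm′)(K, ⌊K/m⌋) + (Rm + Rm′)(K+1, ⌊K/m⌋)` — summable by the socket's own summability clause — and constants
shifted by the `E`'s (`pintCauchyAt_of_pintCauchyAt`): «∃ admissible Cauchy data» and «∀ admissible data, Cauchy» are interchangeable.  No estimate
of Bałaban's or King's is asserted; nothing is constructed.

References: T. Bałaban, CMP 102 (1985) 255–275 [Balaban1985UV3] ((41) p.266, (47) p.267); C. King, CMP 102 (1986) 649–677 [King1986] (Thm 3.4 (3.9) p.656).
-/

noncomputable section

open MeasureTheory Filter Topology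
open Literature.MathematicalPhysics.QuantumFieldTheory.Balaban1983to89
open Literature.MathematicalPhysics.QuantumFieldTheory.Balaban1983to89.T3ContinuumYM3Torus
open Literature.MathematicalPhysics.QuantumFieldTheory.Balaban1983to89.T3UnitLawDensityEML (ℰp measurableE_ℰp)
open Literature.MathematicalPhysics.QuantumFieldTheory.Balaban1983to89.T3UnitScaleTilt
open Literature.MathematicalPhysics.QuantumFieldTheory.Balaban1983to89.T3TiltDescent
open Literature.MathematicalPhysics.QuantumFieldTheory.Balaban1983to89.T3PrintedRegularMinimiser
open Literature.MathematicalPhysics.QuantumFieldTheory.Balaban1983to89.T3LogComparisonSocket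
open Literature.MathematicalPhysics.QuantumFieldTheory.Balaban1983to89.Missing

namespace Summit.QuantumFields.YangMills.Theorems.LogComparisonRigidity

variable {F : T3Family} {γ b₀ p₀ ε₀ : ℝ}
  {Pint Pint' : (K n : ℕ) → GaugeField (F.P n) 0 (Matrix.specialUnitaryGroup (Fin 2) ℂ) → ℝ} {E Rm E' Rm' : ℕ → ℕ → ℝ}

/-- Pointwise core: two two-sided representations `|x + b − p + e| ≤ R`, `|x + b − p′ + e′| ≤ R′` of the same quantity `x + b` force
`|p − p′ − (e − e′)| ≤ R + R′`. [folklore] -/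
theorem abs_sub_sub_le_of_two_reps {x b p e R p' e' R' : ℝ} (h : |x + b - p + e| ≤ R) (h' : |x + b - p' + e'| ≤ R') :
    |p - p' - (e - e')| ≤ R + R' := by
  obtain ⟨h1, h2⟩ := abs_le.mp h
  obtain ⟨h1', h2'⟩ := abs_le.mp h'
  exact abs_le.mpr ⟨by linarith, by linarith⟩

/-- **RIGIDITY OF THE TWO-SIDED REPRESENTATION**: if `(Pint, E, Rm)` and `(Pint′, E′, Rm′)` are both admissible data for the socket
`TwoSidedRepAt` (same family, coupling, windows, `ε₀`), then for every run `K` and height `n ≤ K`, a.e. on the `θBal(n)`-small data with positive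
restricted height density, `|Pint K n V − Pint′ K n V − (E K n − E′ K n)| ≤ Rm K n + Rm′ K n` — an unstructured representation determines its
interaction term only up to `± Rm` (route owner ruling g15-№1 (2)). [cite: Balaban1985UV3, (41) p.266 and (47) p.267] -/
theorem abs_pint_sub_pint_le (h : TwoSidedRepAt F γ b₀ p₀ ε₀ Pint E Rm) (h' : TwoSidedRepAt F γ b₀ p₀ ε₀ Pint' E' Rm')
    (K n : ℕ) (hn : n ≤ K) :
    ∀ᵐ V ∂fieldMeasure (F.P n) 0 (Matrix.specialUnitaryGroup (Fin 2) ℂ), PlaqSmall (θBal F.L γ b₀ p₀ n) V →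
      0 < heightDensity F γ hn (histGood F ℰp (θBal F.L γ b₀ p₀) K n) V →
        |Pint K n V - Pint' K n V - (E K n - E' K n)| ≤ Rm K n + Rm' K n := by
  filter_upwards [h.2.2 K n hn, h'.2.2 K n hn] with V hV hV' hs hpos
  exact abs_sub_sub_le_of_two_reps (hV hs hpos) (hV' hs hpos)

/-- **THE CUT-OFF-CAUCHY PROPERTY IS INVARIANT UNDER THE CHANGE OF ADMISSIBLE DATA**: for `m ≥ 1`, if `Pint` is cut-off-Cauchy along the free
fraction `1/m` and both `(Pint, E, Rm)`, `(Pint′, E′, Rm′)` are admissible, then `Pint′` is cut-off-Cauchy, with radii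
`r′_K + (Rm + Rm′)(K, ⌊K/m⌋) + (Rm + Rm′)(K+1, ⌊K/m⌋)` (summable by the socket's own clause) and constants `c_K − ((E − E′)(K+1, ⌊K/m⌋) − (E − E′)(K, ⌊K/m⌋))`.
Hence «∃ admissible Cauchy data» ⇔ «every admissible datum is Cauchy». [cite: King1986, Thm 3.4 (3.9) p.656] -/
theorem pintCauchyAt_of_pintCauchyAt {m : ℕ} (hm : 0 < m) (hc : PintCauchyAt F γ b₀ p₀ m Pint)
    (h : TwoSidedRepAt F γ b₀ p₀ ε₀ Pint E Rm) (h' : TwoSidedRepAt F γ b₀ p₀ ε₀ Pint' E' Rm') :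
    PintCauchyAt F γ b₀ p₀ m Pint' := by
  obtain ⟨r', c, hr', hr'0, hC⟩ := hc
  refine ⟨fun K => r' K + ((Rm K (K / m) + Rm' K (K / m)) + (Rm (K + 1) (K / m) + Rm' (K + 1) (K / m))),
    fun K => c K - ((E (K + 1) (K / m) - E' (K + 1) (K / m)) - (E K (K / m) - E' K (K / m))), ?_, ?_, fun K => ?_⟩
  · have hs := (h.2.1 m hm).add (h'.2.1 m hm)
    refine hr'.add ?_
    refine hs.congr fun K => ?_
    show Rm K (K / m) + Rm (K + 1) (K / m) + (Rm' K (K / m) + Rm' (K + 1) (K / m)) = _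
    ring
  · intro K
    exact add_nonneg (hr'0 K) (add_nonneg (add_nonneg (h.1 _ _) (h'.1 _ _)) (add_nonneg (h.1 _ _) (h'.1 _ _)))
  · filter_upwards [hC K, abs_pint_sub_pint_le h h' K (K / m) (Nat.div_le_self K m),
      abs_pint_sub_pint_le h h' (K + 1) (K / m) ((Nat.div_le_self K m).trans (Nat.le_succ K))] with V hV h0 h1 hs hp0 hp1
    obtain ⟨a1, a2⟩ := abs_le.mp (hV hs hp0 hp1)
    obtain ⟨b1, b2⟩ := abs_le.mp (h0 hs hp0)
    obtain ⟨c1, c2⟩ := abs_le.mp (h1 hs hp1)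
    exact abs_le.mpr ⟨by linarith, by linarith⟩

end Summit.QuantumFields.YangMills.Theorems.LogComparisonRigidity

end
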